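import Summits.AtomisticToContinuum.HydrodynamicLimit.Theorems.EnskogAdjointDualityCollisionResidualVanishesCutoffAssembly
import HarnessLib

/-!
# EnskogAdjointDuality / CollisionResidualVanishes — the FORWARD `L²` duality assembly under a velocity cutoff
# (cutoff toolkit T4′, the core of the repaired deciding theorem `closes′`)

Support theorem for the crux `Summit.AtomisticToContinuum.HydrodynamicLimit.Theses.EnskogAdjointDuality.CollisionResidualVanishes`
(K1, stmt-AtomisticToContinuum-14658, line `birth`, lead c6). The sibling crux `AdjointEnskogTestFamilyR` (K2R) is false
AS TYPED (2026-08-17, `Cruxes/AdjointEnskogTestFamilyR/HyperVelocityObstruction.md`); its repair asks the defect bound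
`|Dφ^N + L^Nφ^N| ≤ η_N(1+|v|²)` only for `‖v‖ ≤ N + 1` plus a global polynomial bound `C_g(1+|v|²)³`. The route's
deciding theorem `closes` consumes K1 and K2R through the forward `L²` assembly `duality_assembly` (K1's residual → the
tested hydrodynamic quantity at time `t`). This file re-proves that forward assembly under the CUTOFF premise, so that the
repaired `closes′` is the landed proof with `duality_assembly` replaced by `duality_assembly_cut`:

* `pathwise_duality_bound_poly` — the crude forward pathwise bound under the global polynomial defect bound;
* `duality_assembly_cut` — the statement (energy event `Σⱼ|vⱼ|² ≤ (N+1)²` + `pathwise_duality_bound_cut`; complement +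
  `pathwise_duality_bound_poly` + Markov weight `(e/(N+1))³` + twelfth moments, exactly as in `residual_assembly_cut`);
* `cutoff_duality_assembly` — its registered closed form.

References: M. Pulvirenti, S. Simonella, arXiv:1504.03215, §2 [PulvirentiSimonella2016]; H. Spohn (1991), Part I §3.2 [Spohn1991].
-/

noncomputable section

open MeasureTheory Set Filter Topology Function
open scoped ENNReal BigOperators InnerProductSpace

namespace Summit.AtomisticToContinuum.HydrodynamicLimit.Theorems

open Literature.Analysis.FluidPDE Literature.MathematicalPhysics.KineticTheory

section Pathwise

variable {N : ℕ} {ε : ℝ}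

/-- **Polynomial version (no smallness) of the forward pathwise duality estimate.** If
`|Dφ + Lφ| ≤ C_g (1+|v|²)³` for all `v` on `[0, t]`, then along a good orbit
`|A_t − B_t| ≤ |A_0 − B_0| + C_g (1 + Σⱼ|vⱼ(0)|²)² t (1 + e(z)) + |I₃ + ½I₂| + |R| + |Res|`
(below the energy shell `(1+|v|²)³ ≤ (1 + Σⱼ|vⱼ|²)²(1+|v|²)`, then `pathwise_duality_bound_cut`).
[cite: PulvirentiSimonella2016, §2] -/
theorem pathwise_duality_bound_poly (Φ : HardSphereFlow (Torus.geometry (Fin 3)) ε (N + 1))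
    {z : Config (N + 1) (Fin 3) T3} (hz : z ∈ Φ.good) {t : ℝ} (ht : 0 < t)
    (φ L : ℝ → T3 → V3 → ℝ) {Cg : ℝ}
    (hφ : ∀ x v, ContDiffOn ℝ 1
      (fun r => φ r ((Torus.geometry (Fin 3)).translate x (r • v)) v) (Icc 0 t))
    (hDLg : ∀ s ∈ Icc 0 t, ∀ x v,
      |derivWithin (fun r => φ r ((Torus.geometry (Fin 3)).translate x ((r - s) • v)) v) (Icc 0 t) s +
        L s x v| ≤ Cg * (1 + ‖v‖ ^ 2) ^ 3)
    (hLint : IntegrableOn (fun s => ∫ y, L s y.1 y.2 ∂(empiricalMeasure (Φ.flow s z))) (Icc 0 t))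
    {Rz Res I₂ I₃ Bt B0 : ℝ}
    (hR : Rz = ((N : ℝ) + 1)⁻¹ *
        (∑ᶠ (s : ℝ) (_ : s ∈ collisionTimes (Torus.geometry (Fin 3)) ε (fun r => Φ.flow r z) ∩ Ioc 0 t),
          ∑ i : Fin (N + 1), ∑ j : Fin (N + 1),
            (if i ≠ j ∧ ‖(Torus.geometry (Fin 3)).sepVec (Φ.flow s z i).1 (Φ.flow s z j).1‖ = ε then
              φ s (Φ.flow s z i).1 (Φ.flow s z i).2 -
                φ s (Φ.flow s z i).1
                  (reflectVel ((Torus.geometry (Fin 3)).sepVec (Φ.flow s z i).1 (Φ.flow s z j).1)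
                    ((Φ.flow s z i).2, (Φ.flow s z j).2)).1
            else 0)) -
        (∫ s in Icc 0 t, ∫ y, L s y.1 y.2 ∂(empiricalMeasure (Φ.flow s z))) + (1 / 2 : ℝ) * I₂)
    (hRes : Res = Bt - B0 - I₃) :
    |((N : ℝ) + 1)⁻¹ * (∑ i, φ t (Φ.flow t z i).1 (Φ.flow t z i).2) - Bt| ≤
      |((N : ℝ) + 1)⁻¹ * (∑ i, φ 0 (z i).1 (z i).2) - B0| +
        Cg * (1 + ∑ j, ‖(z j).2‖ ^ 2) ^ 2 * t * (1 + ((N + 1 : ℕ) : ℝ)⁻¹ * ∑ i, ‖(z i).2‖ ^ 2) +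
        |I₃ + (1 / 2 : ℝ) * I₂| + |Rz| + |Res| := by
  set S : ℝ := ∑ j, ‖(z j).2‖ ^ 2 with hS
  have hS0 : 0 ≤ S := by positivity
  have hCg : 0 ≤ Cg := by
    have h := (abs_nonneg _).trans (hDLg 0 ⟨le_rfl, ht.le⟩ 0 0)
    have h1 : (0 : ℝ) ≤ Cg * 1 := by simpa using h
    linarith
  -- below the energy shell the polynomial bound is a bound of `pathwise_duality_bound_cut` type
  have hDL : ∀ s ∈ Icc 0 t, ∀ x v, ‖v‖ ^ 2 ≤ S →
      |derivWithin (fun r => φ r ((Torus.geometry (Fin 3)).translate x ((r - s) • v)) v) (Icc 0 t) s +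
        L s x v| ≤ Cg * (1 + S) ^ 2 * (1 + ‖v‖ ^ 2) := by
    intro s hs x v hv
    refine (hDLg s hs x v).trans ?_
    have h1 : (1 + ‖v‖ ^ 2) ^ 3 = (1 + ‖v‖ ^ 2) ^ 2 * (1 + ‖v‖ ^ 2) := by ring
    have h2 : (1 + ‖v‖ ^ 2) ^ 2 ≤ (1 + S) ^ 2 :=
      pow_le_pow_left₀ (by positivity) (by linarith) 2
    rw [h1, mul_assoc]
    exact mul_le_mul_of_nonneg_left (mul_le_mul_of_nonneg_right h2 (by positivity)) hCg
  exact pathwise_duality_bound_cut Φ hz ht φ L hφ hDL hLint hR hRes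


end Pathwise

/-- `(a + b + c + d + e + g)² ≤ 6 (a² + b² + c² + d² + e² + g²)`. [folklore] -/
private theorem sq_add_six_le_fwd (a b c d e g : ℝ) :
    (a + b + c + d + e + g) ^ 2 ≤ 6 * (a ^ 2 + b ^ 2 + c ^ 2 + d ^ 2 + e ^ 2 + g ^ 2) := by
  nlinarith [sq_nonneg (a - b), sq_nonneg (a - c), sq_nonneg (a - d), sq_nonneg (a - e),
    sq_nonneg (a - g), sq_nonneg (b - c), sq_nonneg (b - d), sq_nonneg (b - e), sq_nonneg (b - g),
    sq_nonneg (c - d), sq_nonneg (c - e), sq_nonneg (c - g), sq_nonneg (d - e), sq_nonneg (d - g),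
    sq_nonneg (e - g)]

/-- Real sequences tending to `0` have `ENNReal.ofReal` of their squares tending to `0`.
[folklore] -/
private theorem tendsto_ofReal_sq_of_tendsto_zero_fwd {g : ℕ → ℝ} (hg : Tendsto g atTop (𝓝 0)) :
    Tendsto (fun N => ENNReal.ofReal (g N ^ 2)) atTop (𝓝 0) := by
  have h : Tendsto (fun N => g N ^ 2) atTop (𝓝 0) := by simpa using hg.pow 2
  simpa using ENNReal.tendsto_ofReal h

variable {a₀ θ₀ : T3 → ℝ} {u₀ : T3 → V3}

/-- **The forward `L²` duality assembly under a velocity cutoff.** As `duality_assembly` ((b) the collision residual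
`R_N` with `∫ R_N² dP_N → 0`; (c) Enskog defect of `f` tested on the family `→ 0`; (d) `I₃ + ½I₂ → 0`; (e) the `t = 0`
term `→ 0` in `L²`), but with the regularity/defect premise (a) in CUTOFF form: `C¹` along free flight and
`|Dφ^N + L^Nφ^N| ≤ η_N(1+|v|²)` only for `‖v‖ ≤ N + 1`, eventually, `η_N → 0`, plus a global polynomial bound
`|Dφ^N + L^Nφ^N| ≤ C_g(1+|v|²)³`. Conclusion unchanged: `⟨μ^N_t, φ^N_t⟩ − ∫∫ f_t φ^N_t → 0` in `L²(P_N)` under the local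
Gibbs laws (`σ ≤ 1/2`). Proof: below the energy event `Σⱼ|vⱼ|² ≤ (N+1)²` the pathwise estimate
`pathwise_duality_bound_cut`; above it `pathwise_duality_bound_poly` and the Markov weight `(e/(N+1))³`
(`poly_term_le_weight`), paid by the twelfth moment of `1 + e` (`exists_lintegral_one_add_energy_pow_flow_le`).
[cite: PulvirentiSimonella2016, §2] -/
theorem duality_assembly_cut (ha : Continuous a₀) (hθ : Continuous θ₀) (hu : Continuous u₀)
    (ha0 : ∀ x, 0 < a₀ x) (hθ0 : ∀ x, 0 < θ₀ x) {σ : ℝ} (hσ : σ ≤ 1 / 2)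
    (Φ : (N : ℕ) → HardSphereFlow (Torus.geometry (Fin 3)) (hsDiameter σ N) (N + 1))
    {t : ℝ} (ht : 0 < t)
    (φ L : ℕ → ℝ → T3 → V3 → ℝ) (f : ℝ → T3 → V3 → ℝ)
    (Rres : (N : ℕ) → Config (N + 1) (Fin 3) T3 → ℝ)
    (hφc : ∀ N, Continuous fun p : ℝ × T3 × V3 => φ N p.1 p.2.1 p.2.2)
    (hreg : ∃ η : ℕ → ℝ, Tendsto η atTop (𝓝 0) ∧ ∃ Cg : ℝ, ∀ᶠ N in atTop,
      (∀ x v, ContDiffOn ℝ 1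
        (fun r => φ N r ((Torus.geometry (Fin 3)).translate x (r • v)) v) (Icc 0 t)) ∧
      (∀ s ∈ Icc 0 t, ∀ x v, ‖v‖ ≤ (N : ℝ) + 1 →
        |derivWithin (fun r => φ N r ((Torus.geometry (Fin 3)).translate x ((r - s) • v)) v)
            (Icc 0 t) s + L N s x v| ≤ η N * (1 + ‖v‖ ^ 2)) ∧
      (∀ s ∈ Icc 0 t, ∀ x v,
        |derivWithin (fun r => φ N r ((Torus.geometry (Fin 3)).translate x ((r - s) • v)) v)
            (Icc 0 t) s + L N s x v| ≤ Cg * (1 + ‖v‖ ^ 2) ^ 3))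
    (hL : ∀ N, ∃ K : ℝ, (∀ s ∈ Icc 0 t, ∀ x v, |L N s x v| ≤ K * (1 + ‖v‖ ^ 2) ^ 2) ∧
      Measurable fun p : ℝ × T3 × V3 => L N (max 0 (min t p.1)) p.2.1 p.2.2)
    (hR : ∀ N z, Rres N z = ((N : ℝ) + 1)⁻¹ *
        (∑ᶠ (s : ℝ) (_ : s ∈ collisionTimes (Torus.geometry (Fin 3)) (hsDiameter σ N)
            (fun r => (Φ N).flow r z) ∩ Ioc 0 t),
          ∑ i : Fin (N + 1), ∑ j : Fin (N + 1),
            (if i ≠ j ∧ ‖(Torus.geometry (Fin 3)).sepVec ((Φ N).flow s z i).1 ((Φ N).flow s z j).1‖ =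
                hsDiameter σ N then
              φ N s ((Φ N).flow s z i).1 ((Φ N).flow s z i).2 -
                φ N s ((Φ N).flow s z i).1
                  (reflectVel ((Torus.geometry (Fin 3)).sepVec ((Φ N).flow s z i).1 ((Φ N).flow s z j).1)
                    (((Φ N).flow s z i).2, ((Φ N).flow s z j).2)).1
            else 0)) -
        (∫ s in Icc 0 t, ∫ y, L N s y.1 y.2 ∂(empiricalMeasure ((Φ N).flow s z))) +
        (1 / 2 : ℝ) * ∫ s in Icc 0 t, ∫ x, ∫ v, f s x v * L N s x v)
    (hK1 : Tendsto (fun N => ∫⁻ z, ENNReal.ofReal (Rres N z ^ 2)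
      ∂localGibbsLaw σ a₀ u₀ θ₀ N (Φ N)) atTop (𝓝 0))
    (hRes : Tendsto (fun N => (∫ x, ∫ v, f t x v * φ N t x v) - (∫ x, ∫ v, f 0 x v * φ N 0 x v) -
      ∫ s in Icc 0 t, ∫ x, ∫ v, f s x v *
        (derivWithin (fun r => φ N r ((Torus.geometry (Fin 3)).translate x ((r - s) • v)) v)
          (Icc 0 t) s + (1 / 2 : ℝ) * L N s x v)) atTop (𝓝 0))
    (hF : Tendsto (fun N => (∫ s in Icc 0 t, ∫ x, ∫ v, f s x v *
        (derivWithin (fun r => φ N r ((Torus.geometry (Fin 3)).translate x ((r - s) • v)) v)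
          (Icc 0 t) s + (1 / 2 : ℝ) * L N s x v)) +
      (1 / 2 : ℝ) * ∫ s in Icc 0 t, ∫ x, ∫ v, f s x v * L N s x v) atTop (𝓝 0))
    (h0 : Tendsto (fun N => ∫⁻ z, ENNReal.ofReal
      ((((N : ℝ) + 1)⁻¹ * (∑ i, φ N 0 (z i).1 (z i).2) - ∫ x, ∫ v, f 0 x v * φ N 0 x v) ^ 2)
      ∂localGibbsLaw σ a₀ u₀ θ₀ N (Φ N)) atTop (𝓝 0)) :
    Tendsto (fun N => ∫⁻ z, ENNReal.ofReal
      ((((N : ℝ) + 1)⁻¹ * (∑ i, φ N t ((Φ N).flow t z i).1 ((Φ N).flow t z i).2) -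
        ∫ x, ∫ v, f t x v * φ N t x v) ^ 2)
      ∂localGibbsLaw σ a₀ u₀ θ₀ N (Φ N)) atTop (𝓝 0) := by
  obtain ⟨η, hη, Cg, hev⟩ := hreg
  haveI hP : ∀ N, IsProbabilityMeasure (localGibbsLaw σ a₀ u₀ θ₀ N (Φ N)) := fun N =>
    isProbabilityMeasure_localGibbsLaw ha hθ hu ha0 hθ0 hσ N (Φ N)
  -- the conserved-energy moment bounds (orders 2 and 12), flow-free
  obtain ⟨Cm, hCm0, hCm⟩ := exists_lintegral_one_add_energy_pow_flow_le ha hθ hu ha0 hθ0 hσ 12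
  have hmomk : ∀ (N : ℕ) (k : ℕ), k ≤ 12 →
      ∫⁻ z, ENNReal.ofReal ((1 + ((N + 1 : ℕ) : ℝ)⁻¹ * ∑ i, ‖(z i).2‖ ^ 2) ^ k)
        ∂localGibbsLaw σ a₀ u₀ θ₀ N (Φ N) ≤ ENNReal.ofReal Cm := by
    intro N k hk
    have hgood : ∀ᵐ z ∂localGibbsLaw σ a₀ u₀ θ₀ N (Φ N), z ∈ (Φ N).good :=
      mem_ae_iff.2 (localGibbsLaw_compl_good_eq_zero (Φ N))
    calc ∫⁻ z, ENNReal.ofReal ((1 + ((N + 1 : ℕ) : ℝ)⁻¹ * ∑ i, ‖(z i).2‖ ^ 2) ^ k)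
          ∂localGibbsLaw σ a₀ u₀ θ₀ N (Φ N)
        = ∫⁻ z, ENNReal.ofReal ((1 + ((N + 1 : ℕ) : ℝ)⁻¹ * ∑ i, ‖((Φ N).flow 0 z i).2‖ ^ 2) ^ k)
          ∂localGibbsLaw σ a₀ u₀ θ₀ N (Φ N) := by
          refine lintegral_congr_ae ?_
          filter_upwards [hgood] with z hz
          rw [(Φ N).flow_zero z hz]
      _ ≤ ENNReal.ofReal Cm := hCm N (Φ N) 0 k hk
  -- names for the scalar sequences
  set fs : ℕ → ℝ := fun N => (∫ s in Icc 0 t, ∫ x, ∫ v, f s x v *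
      (derivWithin (fun r => φ N r ((Torus.geometry (Fin 3)).translate x ((r - s) • v)) v)
        (Icc 0 t) s + (1 / 2 : ℝ) * L N s x v)) +
    (1 / 2 : ℝ) * ∫ s in Icc 0 t, ∫ x, ∫ v, f s x v * L N s x v with hfs
  set res : ℕ → ℝ := fun N => (∫ x, ∫ v, f t x v * φ N t x v) - (∫ x, ∫ v, f 0 x v * φ N 0 x v) -
      ∫ s in Icc 0 t, ∫ x, ∫ v, f s x v *
        (derivWithin (fun r => φ N r ((Torus.geometry (Fin 3)).translate x ((r - s) • v)) v)
          (Icc 0 t) s + (1 / 2 : ℝ) * L N s x v) with hres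
  -- the large-energy weight `C_g t (N+1)⁻¹ → 0`
  set w : ℕ → ℝ := fun N => Cg * t * ((N : ℝ) + 1)⁻¹ with hw
  have hwlim : Tendsto w atTop (𝓝 0) := by
    have h1 : Tendsto (fun N : ℕ => ((N : ℝ) + 1)⁻¹) atTop (𝓝 0) :=
      tendsto_inv_atTop_zero.comp (tendsto_natCast_atTop_atTop.atTop_add tendsto_const_nhds)
    simpa [hw] using h1.const_mul (Cg * t)
  -- the dominating sequence
  set G : ℕ → ℝ≥0∞ := fun N => ENNReal.ofReal 6 *
    ((∫⁻ z, ENNReal.ofReal ((((N : ℝ) + 1)⁻¹ * (∑ i, φ N 0 (z i).1 (z i).2) -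
        ∫ x, ∫ v, f 0 x v * φ N 0 x v) ^ 2) ∂localGibbsLaw σ a₀ u₀ θ₀ N (Φ N)) +
      (ENNReal.ofReal ((η N * t) ^ 2) * ENNReal.ofReal Cm +
      (ENNReal.ofReal (fs N ^ 2) +
      (ENNReal.ofReal (res N ^ 2) +
      (ENNReal.ofReal (w N ^ 2) * ENNReal.ofReal Cm +
      ∫⁻ z, ENNReal.ofReal (Rres N z ^ 2) ∂localGibbsLaw σ a₀ u₀ θ₀ N (Φ N)))))) with hG
  have hGlim : Tendsto G atTop (𝓝 0) := by
    have h2 : Tendsto (fun N => ENNReal.ofReal ((η N * t) ^ 2) * ENNReal.ofReal Cm) atTop (𝓝 0) := by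
      have := ENNReal.Tendsto.mul_const (tendsto_ofReal_sq_of_tendsto_zero_fwd
        (by simpa using hη.mul_const t))
        (Or.inr ENNReal.ofReal_ne_top : (0 : ℝ≥0∞) ≠ 0 ∨ ENNReal.ofReal Cm ≠ ⊤)
      simpa using this
    have h3 : Tendsto (fun N => ENNReal.ofReal (fs N ^ 2)) atTop (𝓝 0) :=
      tendsto_ofReal_sq_of_tendsto_zero_fwd hF
    have h4 : Tendsto (fun N => ENNReal.ofReal (res N ^ 2)) atTop (𝓝 0) :=
      tendsto_ofReal_sq_of_tendsto_zero_fwd hRes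
    have h5 : Tendsto (fun N => ENNReal.ofReal (w N ^ 2) * ENNReal.ofReal Cm) atTop (𝓝 0) := by
      have := ENNReal.Tendsto.mul_const (tendsto_ofReal_sq_of_tendsto_zero_fwd hwlim)
        (Or.inr ENNReal.ofReal_ne_top : (0 : ℝ≥0∞) ≠ 0 ∨ ENNReal.ofReal Cm ≠ ⊤)
      simpa using this
    have hsum := h0.add (h2.add (h3.add (h4.add (h5.add hK1))))
    simp only [add_zero] at hsum
    have := ENNReal.Tendsto.const_mul hsum (Or.inr ENNReal.ofReal_ne_top :
      (0 : ℝ≥0∞) ≠ 0 ∨ ENNReal.ofReal 6 ≠ ⊤)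
    simpa [hG] using this
  -- eventually the pathwise estimates apply
  refine tendsto_of_tendsto_of_tendsto_of_le_of_le' tendsto_const_nhds hGlim
    (Eventually.of_forall fun N => bot_le) ?_
  filter_upwards [hev] with N hN
  obtain ⟨hC1, hdef, hdefg⟩ := hN
  obtain ⟨K, hKb, hKm⟩ := hL N
  have hη0 : 0 ≤ η N := by
    have h := (abs_nonneg _).trans (hdef 0 ⟨le_rfl, ht.le⟩ 0 0 (by rw [norm_zero]; positivity))
    simpa using h
  have hCg0 : 0 ≤ Cg := by
    have h := (abs_nonneg _).trans (hdefg 0 ⟨le_rfl, ht.le⟩ 0 0)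
    have h1 : (0 : ℝ) ≤ Cg * 1 := by simpa using h
    linarith
  set n : ℝ := (N : ℝ) + 1 with hn
  have hn' : ((N + 1 : ℕ) : ℝ) = n := by rw [hn]; push_cast; ring
  have hn1 : 1 ≤ n := by rw [hn]; linarith [(Nat.cast_nonneg N : (0 : ℝ) ≤ N)]
  have hnpos : 0 < n := by linarith
  set B0 : ℝ := ∫ x, ∫ v, f 0 x v * φ N 0 x v with hB0
  set Bt : ℝ := ∫ x, ∫ v, f t x v * φ N t x v with hBt
  set X0 : Config (N + 1) (Fin 3) T3 → ℝ := fun z =>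
    n⁻¹ * (∑ i, φ N 0 (z i).1 (z i).2) - B0 with hX0
  set Xt : Config (N + 1) (Fin 3) T3 → ℝ := fun z =>
    n⁻¹ * (∑ i, φ N t ((Φ N).flow t z i).1 ((Φ N).flow t z i).2) - Bt with hXt
  set en : Config (N + 1) (Fin 3) T3 → ℝ := fun z =>
    ((N + 1 : ℕ) : ℝ)⁻¹ * ∑ i, ‖(z i).2‖ ^ 2 with hen
  -- pointwise a.e. bound
  have hgood : ∀ᵐ z ∂localGibbsLaw σ a₀ u₀ θ₀ N (Φ N), z ∈ (Φ N).good :=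
    mem_ae_iff.2 (localGibbsLaw_compl_good_eq_zero (Φ N))
  have hpt : ∀ᵐ z ∂localGibbsLaw σ a₀ u₀ θ₀ N (Φ N),
      ENNReal.ofReal (Xt z ^ 2) ≤
        ENNReal.ofReal 6 * (ENNReal.ofReal (X0 z ^ 2) +
          (ENNReal.ofReal ((η N * t) ^ 2) * ENNReal.ofReal ((1 + en z) ^ 2) +
          (ENNReal.ofReal (fs N ^ 2) + (ENNReal.ofReal (res N ^ 2) +
            (ENNReal.ofReal (w N ^ 2) * ENNReal.ofReal ((1 + en z) ^ 12) +
              ENNReal.ofReal (Rres N z ^ 2)))))) := by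
    filter_upwards [hgood] with z hz
    have hLint := integrableOn_enskogL_orbit (Φ N) hz (L N) hKb hKm
    set S : ℝ := ∑ j, ‖(z j).2‖ ^ 2 with hS
    have hS0 : 0 ≤ S := by positivity
    have hen0 : 0 ≤ en z := by positivity
    have henS : en z = n⁻¹ * S := by simp only [hen, hn', hS]
    -- the combined pathwise bound, valid on and off the energy event
    have hcomb : |Xt z| ≤ |X0 z| + η N * t * (1 + en z) + |fs N| + |Rres N z| + |res N| +
        w N * (1 + en z) ^ 6 := by
      by_cases hSle : S ≤ n ^ 2
      · -- below the energy event: the cutoff premise covers every `‖v‖² ≤ S`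
        have hDL : ∀ s ∈ Icc 0 t, ∀ x v, ‖v‖ ^ 2 ≤ ∑ j, ‖(z j).2‖ ^ 2 →
            |derivWithin (fun r => φ N r ((Torus.geometry (Fin 3)).translate x ((r - s) • v)) v)
              (Icc 0 t) s + L N s x v| ≤ η N * (1 + ‖v‖ ^ 2) := by
          intro s hs x v hv
          refine hdef s hs x v ?_
          have hv2 : ‖v‖ ^ 2 ≤ n ^ 2 := hv.trans hSle
          exact (pow_le_pow_iff_left₀ (norm_nonneg v) hnpos.le two_ne_zero).1 hv2
        have hpw := pathwise_duality_bound_cut (Φ N) hz ht (φ N) (L N) hC1 hDL hLint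
          (Rz := Rres N z) (Res := res N) (I₂ := ∫ s in Icc 0 t, ∫ x, ∫ v, f s x v * L N s x v)
          (I₃ := ∫ s in Icc 0 t, ∫ x, ∫ v, f s x v *
            (derivWithin (fun r => φ N r ((Torus.geometry (Fin 3)).translate x ((r - s) • v)) v)
              (Icc 0 t) s + (1 / 2 : ℝ) * L N s x v)) (Bt := Bt) (B0 := B0) (hR N z)
          (by simp only [hres, hBt, hB0])
        have h1 : |Xt z| ≤ |X0 z| + η N * t * (1 + en z) + |fs N| + |Rres N z| + |res N| := by
          simpa only [hXt, hX0, hen, hfs] using hpw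
        have hw0 : 0 ≤ w N * (1 + en z) ^ 6 := by
          have : 0 ≤ w N := by simp only [hw]; positivity
          positivity
        linarith
      · -- above the energy event: global polynomial bound + Markov weight
        rw [not_le] at hSle
        have hpw := pathwise_duality_bound_poly (Φ N) hz ht (φ N) (L N) hC1 hdefg hLint
          (Rz := Rres N z) (Res := res N) (I₂ := ∫ s in Icc 0 t, ∫ x, ∫ v, f s x v * L N s x v)
          (I₃ := ∫ s in Icc 0 t, ∫ x, ∫ v, f s x v *
            (derivWithin (fun r => φ N r ((Torus.geometry (Fin 3)).translate x ((r - s) • v)) v)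
              (Icc 0 t) s + (1 / 2 : ℝ) * L N s x v)) (Bt := Bt) (B0 := B0) (hR N z)
          (by simp only [hres, hBt, hB0])
        have h1 : |Xt z| ≤ |X0 z| + Cg * (1 + S) ^ 2 * t * (1 + en z) + |fs N| + |Rres N z| +
            |res N| := by
          simpa only [hXt, hX0, hen, hfs, hS] using hpw
        have hwt : Cg * (1 + S) ^ 2 * t * (1 + en z) ≤ w N * (1 + en z) ^ 6 := by
          rw [henS]
          simpa only [hw] using poly_term_le_weight hn1 hSle hCg0 ht.le
        have hηt : 0 ≤ η N * t * (1 + en z) := by positivity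
        linarith
    have hsq : Xt z ^ 2 ≤
        6 * (X0 z ^ 2 + (η N * t) ^ 2 * (1 + en z) ^ 2 + fs N ^ 2 + res N ^ 2 +
          w N ^ 2 * (1 + en z) ^ 12 + Rres N z ^ 2) := by
      calc Xt z ^ 2 = |Xt z| ^ 2 := (sq_abs _).symm
        _ ≤ (|X0 z| + η N * t * (1 + en z) + |fs N| + |Rres N z| + |res N| +
            w N * (1 + en z) ^ 6) ^ 2 := pow_le_pow_left₀ (abs_nonneg _) hcomb 2
        _ ≤ 6 * (|X0 z| ^ 2 + (η N * t * (1 + en z)) ^ 2 + |fs N| ^ 2 + |Rres N z| ^ 2 +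
            |res N| ^ 2 + (w N * (1 + en z) ^ 6) ^ 2) := sq_add_six_le_fwd _ _ _ _ _ _
        _ = 6 * (X0 z ^ 2 + (η N * t) ^ 2 * (1 + en z) ^ 2 + fs N ^ 2 + res N ^ 2 +
            w N ^ 2 * (1 + en z) ^ 12 + Rres N z ^ 2) := by
            simp only [sq_abs]; ring
    calc ENNReal.ofReal (Xt z ^ 2)
        ≤ ENNReal.ofReal (6 * (X0 z ^ 2 + (η N * t) ^ 2 * (1 + en z) ^ 2 + fs N ^ 2 + res N ^ 2 +
            w N ^ 2 * (1 + en z) ^ 12 + Rres N z ^ 2)) := ENNReal.ofReal_le_ofReal hsq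
      _ = _ := by
          rw [ENNReal.ofReal_mul (by norm_num), ENNReal.ofReal_add (by positivity) (by positivity),
            ENNReal.ofReal_add (by positivity) (by positivity),
            ENNReal.ofReal_add (by positivity) (by positivity),
            ENNReal.ofReal_add (by positivity) (by positivity),
            ENNReal.ofReal_add (by positivity) (by positivity), ENNReal.ofReal_mul (by positivity),
            ENNReal.ofReal_mul (by positivity)]
          ring
  -- measurability of the summands that need it
  have hcoord : ∀ i : Fin (N + 1), Measurable fun y : Config (N + 1) (Fin 3) T3 => y i :=
    fun i => measurable_pi_apply i
  have hX0m : Measurable fun z => ENNReal.ofReal (X0 z ^ 2) := by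
    have hm : Measurable X0 := by
      refine (Measurable.const_mul ?_ _).sub measurable_const
      refine Finset.measurable_sum _ fun i _ => ?_
      exact (hφc N).measurable.comp (measurable_const.prodMk
        ((hcoord i).fst.prodMk (hcoord i).snd))
    exact (hm.pow_const 2).ennreal_ofReal
  have henmeas : Measurable en := by
    refine Measurable.const_mul ?_ _
    exact Finset.measurable_sum _ fun i _ => ((hcoord i).snd.norm).pow_const 2
  have henm : Measurable fun z => ENNReal.ofReal ((η N * t) ^ 2) * ENNReal.ofReal ((1 + en z) ^ 2) :=
    (((measurable_const.add henmeas).pow_const 2).ennreal_ofReal).const_mul _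
  have hwm : Measurable fun z => ENNReal.ofReal (w N ^ 2) * ENNReal.ofReal ((1 + en z) ^ 12) :=
    (((measurable_const.add henmeas).pow_const 12).ennreal_ofReal).const_mul _
  have hfsm : Measurable fun _z : Config (N + 1) (Fin 3) T3 => ENNReal.ofReal (fs N ^ 2) :=
    measurable_const
  have hresm : Measurable fun _z : Config (N + 1) (Fin 3) T3 => ENNReal.ofReal (res N ^ 2) :=
    measurable_const
  -- integrate
  calc ∫⁻ z, ENNReal.ofReal (Xt z ^ 2) ∂localGibbsLaw σ a₀ u₀ θ₀ N (Φ N)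
      ≤ ∫⁻ z, ENNReal.ofReal 6 * (ENNReal.ofReal (X0 z ^ 2) +
          (ENNReal.ofReal ((η N * t) ^ 2) * ENNReal.ofReal ((1 + en z) ^ 2) +
          (ENNReal.ofReal (fs N ^ 2) + (ENNReal.ofReal (res N ^ 2) +
            (ENNReal.ofReal (w N ^ 2) * ENNReal.ofReal ((1 + en z) ^ 12) +
              ENNReal.ofReal (Rres N z ^ 2))))))
          ∂localGibbsLaw σ a₀ u₀ θ₀ N (Φ N) := lintegral_mono_ae hpt
    _ = ENNReal.ofReal 6 * ((∫⁻ z, ENNReal.ofReal (X0 z ^ 2) ∂localGibbsLaw σ a₀ u₀ θ₀ N (Φ N)) +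
          (ENNReal.ofReal ((η N * t) ^ 2) *
              ∫⁻ z, ENNReal.ofReal ((1 + en z) ^ 2) ∂localGibbsLaw σ a₀ u₀ θ₀ N (Φ N) +
          (ENNReal.ofReal (fs N ^ 2) + (ENNReal.ofReal (res N ^ 2) +
            (ENNReal.ofReal (w N ^ 2) *
              ∫⁻ z, ENNReal.ofReal ((1 + en z) ^ 12) ∂localGibbsLaw σ a₀ u₀ θ₀ N (Φ N) +
              ∫⁻ z, ENNReal.ofReal (Rres N z ^ 2) ∂localGibbsLaw σ a₀ u₀ θ₀ N (Φ N)))))) := by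
        rw [lintegral_const_mul' _ _ ENNReal.ofReal_ne_top, lintegral_add_left hX0m,
          lintegral_add_left henm, lintegral_const_mul' _ _ ENNReal.ofReal_ne_top,
          lintegral_add_left hfsm, lintegral_add_left hresm, lintegral_add_left hwm,
          lintegral_const_mul' _ _ ENNReal.ofReal_ne_top, lintegral_const, lintegral_const,
          measure_univ, mul_one, mul_one]
    _ ≤ G N := by
        simp only [hG]
        gcongr
        · exact hmomk N 2 (by norm_num)
        · exact hmomk N 12 le_rfl

/-- **Registered form** (sub-goal `cutoff_duality_assembly` of the crux stmt-AtomisticToContinuum-14658, line `birth`): `duality_assembly_cut` as a closed `∀`-statement — the forward `L²` duality assembly with the defect premise in velocity-cutoff form (the core of the repaired deciding theorem `closes′`). [cite: PulvirentiSimonella2016, §2] -/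
theorem cutoff_duality_assembly : ∀ {a₀ θ₀ : T3 → ℝ} {u₀ : T3 → V3} (ha : Continuous a₀) (hθ : Continuous θ₀) (hu : Continuous u₀) (ha0 : ∀ x, 0 < a₀ x) (hθ0 : ∀ x, 0 < θ₀ x) {σ : ℝ} (hσ : σ ≤ 1 / 2) (Φ : (N : ℕ) → HardSphereFlow (Torus.geometry (Fin 3)) (hsDiameter σ N) (N + 1)) {t : ℝ} (ht : 0 < t) (φ L : ℕ → ℝ → T3 → V3 → ℝ) (f : ℝ → T3 → V3 → ℝ) (Rres : (N : ℕ) → Config (N + 1) (Fin 3) T3 → ℝ) (hφc : ∀ N, Continuous fun p : ℝ × T3 × V3 => φ N p.1 p.2.1 p.2.2) (hreg : ∃ η : ℕ → ℝ, Tendsto η atTop (𝓝 0) ∧ ∃ Cg : ℝ, ∀ᶠ N in atTop, (∀ x v, ContDiffOn ℝ 1 (fun r => φ N r ((Torus.geometry (Fin 3)).translate x (r • v)) v) (Icc 0 t)) ∧ (∀ s ∈ Icc 0 t, ∀ x v, ‖v‖ ≤ (N : ℝ) + 1 → |derivWithin (fun r => φ N r ((Torus.geometry (Fin 3)).translate x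 ((r - s) • v)) v) (Icc 0 t) s + L N s x v| ≤ η N * (1 + ‖v‖ ^ 2)) ∧ (∀ s ∈ Icc 0 t, ∀ x v, |derivWithin (fun r => φ N r ((Torus.geometry (Fin 3)).translate x ((r - s) • v)) v) (Icc 0 t) s + L N s x v| ≤ Cg * (1 + ‖v‖ ^ 2) ^ 3)) (hL : ∀ N, ∃ K : ℝ, (∀ s ∈ Icc 0 t, ∀ x v, |L N s x v| ≤ K * (1 + ‖v‖ ^ 2) ^ 2) ∧ Measurable fun p : ℝ × T3 × V3 => L N (max 0 (min t p.1)) p.2.1 p.2.2) (hR : ∀ N z, Rres N z = ((N : ℝ) + 1)⁻¹ * (∑ᶠ (s : ℝ) (_ : s ∈ collisionTimes (Torus.geometry (Fin 3)) (hsDiameter σ N) (fun r => (Φ N).flow r z) ∩ Ioc 0 t), ∑ i : Fin (N + 1), ∑ j : Fin (N + 1), (if i ≠ j ∧ ‖(Torus.geometry (Fin 3)).sepVec ((Φ N).flow s z i).1 ((Φ N).flow s z j).1‖ = hsDiameter σ N then φ N s ((Φ N).flow s z i).1 ((Φ N).flow s z i).2 - φ N s ((Φ N).flow s z i).1 (reflectVel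 ((Torus.geometry (Fin 3)).sepVec ((Φ N).flow s z i).1 ((Φ N).flow s z j).1) (((Φ N).flow s z i).2, ((Φ N).flow s z j).2)).1 else 0)) - (∫ s in Icc 0 t, ∫ y, L N s y.1 y.2 ∂(empiricalMeasure ((Φ N).flow s z))) + (1 / 2 : ℝ) * ∫ s in Icc 0 t, ∫ x, ∫ v, f s x v * L N s x v) (hK1 : Tendsto (fun N => ∫⁻ z, ENNReal.ofReal (Rres N z ^ 2) ∂localGibbsLaw σ a₀ u₀ θ₀ N (Φ N)) atTop (𝓝 0)) (hRes : Tendsto (fun N => (∫ x, ∫ v, f t x v * φ N t x v) - (∫ x, ∫ v, f 0 x v * φ N 0 x v) - ∫ s in Icc 0 t, ∫ x, ∫ v, f s x v * (derivWithin (fun r => φ N r ((Torus.geometry (Fin 3)).translate x ((r - s) • v)) v) (Icc 0 t) s + (1 / 2 : ℝ) * L N s x v)) atTop (𝓝 0)) (hF : Tendsto (fun N => (∫ s in Icc 0 t, ∫ x, ∫ v, f s x v * (derivWithin (fun r => φ N r ((Torus.geometry (Fin 3)).translate x ((r - s) • v)) v) (Icc 0 t) s + (1 / 2 : ℝ) *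 L N s x v)) + (1 / 2 : ℝ) * ∫ s in Icc 0 t, ∫ x, ∫ v, f s x v * L N s x v) atTop (𝓝 0)) (h0 : Tendsto (fun N => ∫⁻ z, ENNReal.ofReal ((((N : ℝ) + 1)⁻¹ * (∑ i, φ N 0 (z i).1 (z i).2) - ∫ x, ∫ v, f 0 x v * φ N 0 x v) ^ 2) ∂localGibbsLaw σ a₀ u₀ θ₀ N (Φ N)) atTop (𝓝 0)), Tendsto (fun N => ∫⁻ z, ENNReal.ofReal ((((N : ℝ) + 1)⁻¹ * (∑ i, φ N t ((Φ N).flow t z i).1 ((Φ N).flow t z i).2) - ∫ x, ∫ v, f t x v * φ N t x v) ^ 2) ∂localGibbsLaw σ a₀ u₀ θ₀ N (Φ N)) atTop (𝓝 0) :=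
  @duality_assembly_cut

end Summit.AtomisticToContinuum.HydrodynamicLimit.Theorems

end
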